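import Summits.Ventures.Crystal3D.Theorems.StickyWulffConstantCoaxialWallLawEndRowDefs
import Summits.Ventures.Crystal3D.Theorems.StickyWulffConstantGenericWallFloorPackingExtension
import HarnessLib

/-!
# The census row's CENSUS-FREE TAIL INEQUALITIES: vacant sites load the pooled deficiency, and unload the multiplicity

HONEST FRAMING. Venture `Summits/Ventures/Crystal3D` (cell `crystal3d-full`), helper `--supports` the crux
`CoaxialWallLaw` (stmt-Ventures-19481, `route-Ventures-StickyWulffConstant`), REGISTERED line `WallLedgerF`, open stub
`stub_coaxialTwoSlabAdhesion`.  Rung credit only; F-C1 not moved.  PREREG-F-STEP3 ruling D2(ii) (cf-p1 g28,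
15:02:28Z), commissioned from 19481-p2: the two census-free conjuncts that bound the local row statistic
`Σ_b endMult(b)/pooledDef(b)` (`LocalEndRow`, `…EndRowDefs`) OUTSIDE the certificate's finite universe, priced by
19480-p2's packing-extension tool `sum_card_contacts_ext_le_sum_twelve_sub` (p640929):

* `pooledDef_ge_sum_vacancy_contacts` — for every finite set `V` of VACANT SITES (points with `X ∪ V` `1`-separated,
  `V ∩ X = ∅`): `Σ_{v ∈ V} #{y ∈ X : dist(b,y) ≤ 1, dist(v,y) = 1} ≤ pooledDef X b` — every (vacant site, ball of the
  unit ball of `b`) adjacency is a unit of pooled deficiency (the honest form of «D_pool ≥ 12·#vacant − overlaps»);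
* `endMult_add_vacant_le_twelve` — `endMult(b) + #{v ∈ V : dist(b,v) = 1} ≤ 12` (end pairs are contacts of `b`; kissing
  bound for `X ∪ V`), for plate systems with `RT ⊆ fccSlots` (all instantiated ones);
* `endRatio_le_of_vacant` — the quotient form `endMult(b)/pooledDef(b) ≤ (12 − a_V(b)) / c_V(b)` whenever
  `c_V(b) := Σ_{v} #{…} > 0`.

WHAT THIS IS NOT.  Not the row; not a bound on the per-payer SUM by itself (that needs the certificate's universe
bookkeeping: which `b ∈ B(z,1]` are charged); F-C1 not moved.
-/

noncomputable section

namespace Summit.Ventures.Crystal3D.Theorems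

open Summit.Ventures.Crystal3D Finset
open scoped InnerProductSpace

open scoped Classical in
/-- **Vacant sites load the pooled deficiency.**  See the module docstring. -/
theorem pooledDef_ge_sum_vacancy_contacts (X V : Finset (EuclideanSpace ℝ (Fin 3)))
    (hsep : ∀ p ∈ X ∪ V, ∀ q ∈ X ∪ V, p ≠ q → 1 ≤ dist p q) (hdisj : Disjoint X V)
    (b : EuclideanSpace ℝ (Fin 3)) :
    ∑ v ∈ V, (((X.filter fun y => dist b y ≤ 1).filter fun y => dist v y = 1).card : ℝ) ≤ pooledDef X b := by
  have hX : ∀ p ∈ X, ∀ q ∈ X, p ≠ q → 1 ≤ dist p q := fun p hp q hq hpq =>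
    hsep p (mem_union_left _ hp) q (mem_union_left _ hq) hpq
  set S := X.filter (fun y => dist b y ≤ 1) with hS
  have h := sum_card_contacts_ext_le_sum_twelve_sub X V S hsep hdisj
  have hsum : ∑ y ∈ S, ((12 : ℝ) - ((X.filter fun q => dist y q = 1).card : ℝ)) = pooledDef X b := by
    unfold pooledDef
    rw [← sum_filter_add_sum_filter_not S (fun y => (X.filter fun q => dist y q = 1).card ≤ 11)]
    have hzero : ∑ y ∈ S.filter (fun y => ¬ (X.filter fun q => dist y q = 1).card ≤ 11),
        ((12 : ℝ) - ((X.filter fun q => dist y q = 1).card : ℝ)) = 0 := by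
      refine sum_eq_zero fun y hy => ?_
      obtain ⟨hyS, hy11⟩ := mem_filter.1 hy
      have h12 := card_filter_dist_eq_one_le_twelve X hX y
      have : (X.filter fun q => dist y q = 1).card = 12 := by omega
      rw [this]; norm_num
    rw [hzero, add_zero]
    refine sum_congr ?_ fun _ _ => rfl
    ext y
    simp only [hS, mem_filter, and_assoc]
  linarith

/-- In an end pair `(b, q)` of plate systems with slot roots, `q` is a contact of `b`. -/
theorem dist_eq_one_of_isEndPair {X : Finset (EuclideanSpace ℝ (Fin 3))} {v : WordVersion} {S₁ S₂ : PlateSystem}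
    (h₁ : S₁.RT ⊆ fccSlots) (h₂ : S₂.RT ⊆ fccSlots) {b q : EuclideanSpace ℝ (Fin 3)}
    (h : IsEndPair X v S₁ S₂ b q) : dist b q = 1 := by
  obtain ⟨-, -, -, G, d, hadm, hem⟩ := h
  -- `‖d‖ = 1`
  have hd1 : ‖d‖ = 1 := by
    rcases hadm with ⟨r, hr, κ, -, -, hd⟩ | ⟨r, hr, κ, -, -, hd⟩
    · rw [hd, LinearIsometryEquiv.norm_map, norm_smul, norm_pow, norm_neg, norm_one, one_pow, one_mul]
      exact norm_eq_one_of_mem_fccSlots (h₁ hr)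
    · rw [hd, LinearIsometryEquiv.norm_map, norm_smul, norm_pow, norm_neg, norm_one, one_pow, one_mul]
      exact norm_eq_one_of_mem_fccSlots (h₂ hr)
  rcases hem with ⟨-, hb, -⟩ | ⟨m, ⟨⟨hm1, -⟩, -⟩, hdm, hb, -⟩
  · rw [hb, dist_comm, dist_eq_norm, show q - (q + d) = -d by abel, norm_neg, hd1]
  · rw [hb, dist_comm, dist_eq_norm, show q - (q - (d - (2 * ⟪d, m⟫_ℝ) • m)) = d - (2 * ⟪d, m⟫_ℝ) • m by abel]
    -- the mirror image of the unit vector `d` is a unit vector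
    have hsq : ‖d - (2 * ⟪d, m⟫_ℝ) • m‖ ^ 2 = 1 := by
      rw [@norm_sub_sq_real, norm_smul, hm1, mul_one, inner_smul_right, hd1, Real.norm_eq_abs, sq_abs]
      ring
    have h0 : 0 ≤ ‖d - (2 * ⟪d, m⟫_ℝ) • m‖ := norm_nonneg _
    nlinarith [hsq, h0]

open scoped Classical in
/-- **Vacant contacts unload the multiplicity**: `endMult(b) + #{v ∈ V : dist(b,v) = 1} ≤ 12`.  See the module
docstring. -/
theorem endMult_add_vacant_le_twelve (X V : Finset (EuclideanSpace ℝ (Fin 3)))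
    (hsep : ∀ p ∈ X ∪ V, ∀ q ∈ X ∪ V, p ≠ q → 1 ≤ dist p q) (hdisj : Disjoint X V)
    (v : WordVersion) {S₁ S₂ : PlateSystem} (h₁ : S₁.RT ⊆ fccSlots) (h₂ : S₂.RT ⊆ fccSlots)
    (b : EuclideanSpace ℝ (Fin 3)) :
    endMult X v S₁ S₂ b + (V.filter fun w => dist b w = 1).card ≤ 12 := by
  have hle : endMult X v S₁ S₂ b ≤ (X.filter fun q => dist b q = 1).card := by
    unfold endMult
    exact card_le_card fun q hq => by
      rw [mem_filter] at hq ⊢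
      exact ⟨hq.1, dist_eq_one_of_isEndPair h₁ h₂ hq.2⟩
  have hunion : (X.filter fun q => dist b q = 1).card + (V.filter fun w => dist b w = 1).card =
      ((X ∪ V).filter fun q => dist b q = 1).card := by
    rw [filter_union, card_union_of_disjoint (disjoint_filter_filter hdisj)]
  have h12 := card_filter_dist_eq_one_le_twelve (X ∪ V) hsep b
  omega

open scoped Classical in
/-- **The quotient form**: with `a := #{v ∈ V : dist(b,v) = 1}` and `c := Σ_v #{y ∈ X ∩ B(b,1] : dist(v,y) = 1} > 0`,
`endMult(b)/pooledDef(b) ≤ (12 − a)/c`. -/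
theorem endRatio_le_of_vacant (X V : Finset (EuclideanSpace ℝ (Fin 3)))
    (hsep : ∀ p ∈ X ∪ V, ∀ q ∈ X ∪ V, p ≠ q → 1 ≤ dist p q) (hdisj : Disjoint X V)
    (v : WordVersion) {S₁ S₂ : PlateSystem} (h₁ : S₁.RT ⊆ fccSlots) (h₂ : S₂.RT ⊆ fccSlots)
    (b : EuclideanSpace ℝ (Fin 3))
    (hc : 0 < ∑ w ∈ V, (((X.filter fun y => dist b y ≤ 1).filter fun y => dist w y = 1).card : ℝ)) :
    (endMult X v S₁ S₂ b : ℝ) / pooledDef X b ≤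
      ((12 : ℝ) - ((V.filter fun w => dist b w = 1).card : ℝ)) /
        ∑ w ∈ V, (((X.filter fun y => dist b y ≤ 1).filter fun y => dist w y = 1).card : ℝ) := by
  have hpool := pooledDef_ge_sum_vacancy_contacts X V hsep hdisj b
  have hmult : (endMult X v S₁ S₂ b : ℝ) + ((V.filter fun w => dist b w = 1).card : ℝ) ≤ 12 := by
    exact_mod_cast endMult_add_vacant_le_twelve X V hsep hdisj v h₁ h₂ b
  have hpos : 0 < pooledDef X b := lt_of_lt_of_le hc hpool
  rw [div_le_div_iff₀ hpos hc]
  have hm0 : (0 : ℝ) ≤ endMult X v S₁ S₂ b := Nat.cast_nonneg _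
  nlinarith [hpool, hmult, hm0, hc.le]

end Summit.Ventures.Crystal3D.Theorems

end
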